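import Summits.PneNP.PneNP.Theses.KarlinRubin
import Summits.PneNP.PneNP.Theorems.KarlinRubinMonotoneSufficesShiftErrSum
import Summits.PneNP.PneNP.Theorems.KarlinRubinMonotoneSufficesStubMixtureCount
import Summits.PneNP.PneNP.Theorems.KarlinRubinMonotoneSufficesStubMixtureCollision

/-!
# Crux `MonotoneSuffices` (stmt-PneNP-18026), line `Sketch` — mixture-shift rung: the finite
# MIXTURE SHIFT LEMMA (`stub_mixtureShiftErrSum`)

The density-shift rung (`KarlinRubinMonotoneSufficesShiftErrSum.lean`) moved the input of a one-layer
detector `f(x) = F(x, ¬g⃗(x))` by `x ↦ x ∨ 1_R` for a uniformly random `r`-SUBSET `R` of the edge slots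
and paid the slice likelihood ratio. Here the shift set `R` is drawn uniformly from an ARBITRARY finite
family `Rs` (a "mixture of shifts": random stars, random tribes, …), and the price is the COLLISION
number of the family, `Coll(Rs) = E_{R,R'} 2^{#(R ∩ R')}` — the chi-square `E_μ[(dν/dμ)²]` of the
shifted law `ν` against the uniform law `μ` (`stub_mixtureCollision`): by the pointwise AM–GM inequality
`ρ ≤ (η/2) ρ² + 1/(2η)` on the density `ρ = dν/dμ`,

  `ν(A) ≤ (η/2) · Coll(Rs) + μ(A)/(2η)`   for every event `A` and every `η > 0`

(`mixtureErrSum_sum_card_le`, counting form; `mixtureErrSum_sum_measure_le`, probabilities). Since the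
shift commutes with planting and `F` is monotone in the wires, the two inclusions of the shift lemma
(`shiftErrSum_null_subset`, `shiftErrSum_planted_subset`) give, summing over `R ∈ Rs` and choosing the best
`R` (`ENNReal.exists_le_of_sum_le`):

* `stub_mixtureShiftErrSum` — some `R ∈ Rs` has
  `errSum_k(F(· ∨ 1_R, b)) ≤ η · Coll(Rs) + errSum_k(f)/η + 2 · avg_{R'} Pr₀[∃ j, g_j(x ∨ 1_{R'}) = b_j]`,
  for EVERY clique size `k` and every `η > 0` (no tail term, no condition on `k`).

This is the positive half of the shift criterion recorded by prover-1 (session4-shift-levers.md: a coin is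
shift-enterable iff some shift law enters it with bounded collision); the negative half (RecMaj₃ resists
every shift law) is the sibling seat's `recMaj_shiftResistant`.
-/

set_option linter.dupNamespace false -- `Summit.PneNP.PneNP.…`: summit = sub-problem name (D-0017)

namespace Summit.PneNP.PneNP.Theorems.MonotoneSuffices.DensityShift

open Literature.Computability.Complexity Literature.Probability.RandomGraphs.PlantedClique Filter Finset
open scoped ENNReal

/-! ### AM–GM on the shifted density: counts, then `G(n,1/2)`-probabilities -/

/-- Pointwise AM–GM in the form used: `c ≤ (η/(2M)) c² + M/(2η)` for `η, M > 0`. [folklore] -/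
theorem mixtureErrSum_amgm {c η M : ℝ} (hη : 0 < η) (hM : 0 < M) :
    c ≤ η / (2 * M) * c ^ 2 + M / (2 * η) := by
  have h1 : 0 ≤ (η * c - M) ^ 2 := sq_nonneg _
  have hηM : 0 < η * M := mul_pos hη hM
  rw [div_mul_eq_mul_div, div_add_div _ _ (by positivity) (by positivity), le_div_iff₀ (by positivity)]
  nlinarith

/-- **Counting form of the mixture estimate** (generic cube). For every finite family `Rs` of shift sets,
every event `A` and every `η > 0`:
`∑_{R ∈ Rs} #{x | x ∨ 1_R ∈ A} ≤ (η/(2·#Rs)) · 2^N · ∑_{R,R'} 2^{#(R∩R')} + #Rs · #A/(2η)`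
(`stub_mixtureCount`, AM–GM pointwise in `y ∈ A`, `stub_mixtureCollision`). [folklore] -/
theorem mixtureErrSum_sum_card_le {α : Type*} [Fintype α] [DecidableEq α] (Rs : Finset (Finset α))
    (hRs : Rs.Nonempty) (A : Finset (α → Bool)) {η : ℝ} (hη : 0 < η) :
    ∑ R ∈ Rs, (#((univ : Finset (α → Bool)).filter fun x => (fun a => x a || decide (a ∈ R)) ∈ A) : ℝ) ≤
      η / (2 * #Rs) * (2 ^ Fintype.card α * ∑ R ∈ Rs, ∑ R' ∈ Rs, (2 : ℝ) ^ #(R ∩ R')) +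
        #Rs * #A / (2 * η) := by
  have hM : (0 : ℝ) < #Rs := by exact_mod_cast hRs.card_pos
  have hcount : ∑ R ∈ Rs, (#((univ : Finset (α → Bool)).filter fun x => (fun a => x a || decide (a ∈ R)) ∈ A) : ℝ) =
      ∑ y ∈ A, ∑ R ∈ Rs.filter (fun R => R ⊆ univ.filter fun a => y a = true), (2 : ℝ) ^ #R := by
    exact_mod_cast stub_mixtureCount Rs A
  -- the density count `c y`
  set c : (α → Bool) → ℝ := fun y => ∑ R ∈ Rs.filter (fun R => R ⊆ univ.filter fun a => y a = true), (2 : ℝ) ^ #R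
    with hc
  have hcoll : ∑ y : α → Bool, c y ^ 2 = 2 ^ Fintype.card α * ∑ R ∈ Rs, ∑ R' ∈ Rs, (2 : ℝ) ^ #(R ∩ R') := by
    have h := stub_mixtureCollision Rs
    simp only [hc]
    exact_mod_cast h
  rw [hcount]
  calc ∑ y ∈ A, ∑ R ∈ Rs.filter (fun R => R ⊆ univ.filter fun a => y a = true), (2 : ℝ) ^ #R
      = ∑ y ∈ A, c y := rfl
    _ ≤ ∑ y ∈ A, (η / (2 * #Rs) * c y ^ 2 + #Rs / (2 * η)) :=
        sum_le_sum fun y _ => mixtureErrSum_amgm hη hM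
    _ = η / (2 * #Rs) * ∑ y ∈ A, c y ^ 2 + #A * (#Rs / (2 * η)) := by
        rw [sum_add_distrib, ← mul_sum, sum_const, nsmul_eq_mul]
    _ ≤ η / (2 * #Rs) * ∑ y : α → Bool, c y ^ 2 + #A * (#Rs / (2 * η)) :=
        add_le_add (mul_le_mul_of_nonneg_left
          (sum_le_sum_of_subset_of_nonneg (subset_univ A) fun y _ _ => sq_nonneg (c y)) (by positivity)) le_rfl
    _ = _ := by rw [hcoll]; ring

/-- **Probability form of the mixture estimate.** For every test `h` on the edge vectors of `Kₙ`, every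
nonempty family `Rs` of shift sets and every `η > 0`:
`∑_{R ∈ Rs} Pr₀[h(x ∨ 1_R)] ≤ (η/2) · (∑_{R,R'} 2^{#(R∩R')})/#Rs + (#Rs/(2η)) · Pr₀[h]`. [folklore] -/
theorem mixtureErrSum_sum_measure_le {n : ℕ} (Rs : Finset (Finset ((⊤ : SimpleGraph (Fin n)).edgeSet)))
    (hRs : Rs.Nonempty) (h : EdgeVec n → Bool) {η : ℝ} (hη : 0 < η) :
    ∑ R ∈ Rs, (erdosRenyiHalf n).toOuterMeasure {x | h (fun e => x e || decide (e ∈ R)) = true} ≤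
      ENNReal.ofReal (η / 2) * ((∑ R ∈ Rs, ∑ R' ∈ Rs, 2 ^ #(R ∩ R') : ℕ) : ℝ≥0∞) / (#Rs : ℝ≥0∞) +
        ENNReal.ofReal (1 / (2 * η)) * (#Rs : ℝ≥0∞) * (erdosRenyiHalf n).toOuterMeasure {x | h x = true} := by
  classical
  have hcard : Fintype.card ((⊤ : SimpleGraph (Fin n)).edgeSet) = n.choose 2 := card_edgeSet_top_fin n
  set A : Finset (EdgeVec n) := univ.filter fun y => h y = true with hA
  have hM : (0 : ℝ) < #Rs := by exact_mod_cast hRs.card_pos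
  have hM0 : (#Rs : ℝ≥0∞) ≠ 0 := Nat.cast_ne_zero.2 hRs.card_pos.ne'
  have hMtop : (#Rs : ℝ≥0∞) ≠ ⊤ := ENNReal.natCast_ne_top _
  -- the counting estimate on the edge cube
  have hcount := mixtureErrSum_sum_card_le Rs hRs A hη
  rw [hcard] at hcount
  have hcollcast : (((∑ R ∈ Rs, ∑ R' ∈ Rs, 2 ^ #(R ∩ R') : ℕ) : ℝ≥0∞)).toReal =
      ∑ R ∈ Rs, ∑ R' ∈ Rs, (2 : ℝ) ^ #(R ∩ R') := by
    rw [ENNReal.toReal_natCast]; push_cast; rfl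
  have hterm : ∀ R : Finset ((⊤ : SimpleGraph (Fin n)).edgeSet),
      ((erdosRenyiHalf n).toOuterMeasure {x | h (fun e => x e || decide (e ∈ R)) = true}).toReal =
        (#((univ : Finset (EdgeVec n)).filter fun x => (fun a => x a || decide (a ∈ R)) ∈ A) : ℝ) /
          2 ^ n.choose 2 := by
    intro R
    rw [SliceTransport.toReal_erdosRenyiHalf_eq (fun x => h (fun e => x e || decide (e ∈ R)))]
    congr 2
    exact congrArg Finset.card (Finset.ext fun x => by simp only [hA, mem_filter, mem_univ, true_and])
  have hA' : ((erdosRenyiHalf n).toOuterMeasure {x | h x = true}).toReal = (#A : ℝ) / 2 ^ n.choose 2 :=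
    SliceTransport.toReal_erdosRenyiHalf_eq h
  have hfinL : ∑ R ∈ Rs, (erdosRenyiHalf n).toOuterMeasure {x | h (fun e => x e || decide (e ∈ R)) = true} ≠ ⊤ :=
    ENNReal.sum_ne_top.2 fun R _ => shiftErrSum_erdosRenyiHalf_ne_top _
  have hfin1 : ENNReal.ofReal (η / 2) * ((∑ R ∈ Rs, ∑ R' ∈ Rs, 2 ^ #(R ∩ R') : ℕ) : ℝ≥0∞) / (#Rs : ℝ≥0∞) ≠ ⊤ :=
    ENNReal.div_ne_top (ENNReal.mul_ne_top ENNReal.ofReal_ne_top (ENNReal.natCast_ne_top _)) hM0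
  have hfin2 : ENNReal.ofReal (1 / (2 * η)) * (#Rs : ℝ≥0∞) * (erdosRenyiHalf n).toOuterMeasure {x | h x = true} ≠ ⊤ :=
    ENNReal.mul_ne_top (ENNReal.mul_ne_top ENNReal.ofReal_ne_top hMtop) (shiftErrSum_erdosRenyiHalf_ne_top _)
  rw [← ENNReal.toReal_le_toReal hfinL (ENNReal.add_ne_top.2 ⟨hfin1, hfin2⟩),
    ENNReal.toReal_sum (fun R _ => shiftErrSum_erdosRenyiHalf_ne_top _), ENNReal.toReal_add hfin1 hfin2,
    ENNReal.toReal_div, ENNReal.toReal_mul, ENNReal.toReal_mul, ENNReal.toReal_mul,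
    ENNReal.toReal_ofReal (by positivity), ENNReal.toReal_ofReal (by positivity), hcollcast,
    ENNReal.toReal_natCast, hA']
  simp_rw [hterm]
  rw [← sum_div, div_le_iff₀ (by positivity)]
  calc ∑ R ∈ Rs, (#((univ : Finset (EdgeVec n)).filter fun x => (fun a => x a || decide (a ∈ R)) ∈ A) : ℝ)
      ≤ η / (2 * #Rs) * (2 ^ n.choose 2 * ∑ R ∈ Rs, ∑ R' ∈ Rs, (2 : ℝ) ^ #(R ∩ R')) +
          #Rs * #A / (2 * η) := hcount
    _ = (η / 2 * (∑ R ∈ Rs, ∑ R' ∈ Rs, (2 : ℝ) ^ #(R ∩ R')) / #Rs +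
          1 / (2 * η) * #Rs * ((#A : ℝ) / 2 ^ n.choose 2)) * 2 ^ n.choose 2 := by
        field_simp

/-! ### Assembly: the finite mixture shift lemma -/

/-- **`stub_mixtureShiftErrSum` — the finite MIXTURE SHIFT LEMMA** (registered stub of stmt-PneNP-18026,
line `Sketch`, mixture-shift rung). Let `F x` be monotone in the wires and every `g_j` monotone,
`f(x) = F(x, ¬g⃗(x))`, `Rs` a nonempty finite family of sets of edge slots, `η > 0`. Then SOME `R ∈ Rs`
satisfies, for every clique size `k`,
`errSum_k(F(· ∨ 1_R, b)) ≤ η · Coll(Rs) + (1/η) · errSum_k(f) + 2 · avg_{R'∈Rs} Pr₀[∃ j, g_j(x ∨ 1_{R'}) = b_j]`,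
`Coll(Rs) = (∑_{R,R'∈Rs} 2^{#(R∩R')})/#Rs²`. Proof: per `R` the null error is at most
`Pr₀[f(x ∨ 1_R)] + bad(R)` and the planted error at most `E_A Pr₀[¬f(plant_A(x ∨ 1_R))] + bad(R)`
(`shiftErrSum_null_subset`, `shiftErrSum_planted_subset`, `shiftErrSum_plant_ins`); summed over `R`, each
transported term costs `(η/2)·#Rs·Coll + (#Rs/(2η))·(its unshifted probability)`
(`mixtureErrSum_sum_measure_le`, and `E_A Pr₀[¬f ∘ plant_A] = Pr₁[¬f]`); the best `R` is at most the
average. [folklore] -/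
theorem stub_mixtureShiftErrSum :
    ∀ (n k : ℕ) (Rs : Finset (Finset ((⊤ : SimpleGraph (Fin n)).edgeSet))) {κ : Type*}
      (F : EdgeVec n → (κ → Bool) → Bool) (g : κ → EdgeVec n → Bool) (b : κ → Bool) (η : ℝ),
      Rs.Nonempty → (∀ x, Monotone (F x)) → (∀ j, Monotone (g j)) → 0 < η →
      ∃ R ∈ Rs,
        (erdosRenyiHalf n).toOuterMeasure {x | F (fun e => x e || decide (e ∈ R)) b = true} +
            (plantedCliqueDist n k).toOuterMeasure {x | F (fun e => x e || decide (e ∈ R)) b = false} ≤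
          ENNReal.ofReal η * ((∑ R ∈ Rs, ∑ R' ∈ Rs, 2 ^ #(R ∩ R') : ℕ) : ℝ≥0∞) / ((#Rs : ℝ≥0∞) ^ 2) +
            ENNReal.ofReal (1 / η) *
              ((erdosRenyiHalf n).toOuterMeasure {x | F x (fun j => !g j x) = true} +
                (plantedCliqueDist n k).toOuterMeasure {x | F x (fun j => !g j x) = false}) +
            2 * (∑ R' ∈ Rs, (erdosRenyiHalf n).toOuterMeasure
                {x | ∃ j, g j (fun e => x e || decide (e ∈ R')) = b j}) / (#Rs : ℝ≥0∞) := by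
  intro n k Rs κ F g b η hRs hF hg hη
  classical
  -- notation
  set uA := PMF.uniformOfFinset (kSubsets n k) (kSubsets_nonempty n k) with huA
  set Coll : ℝ≥0∞ := ((∑ R ∈ Rs, ∑ R' ∈ Rs, 2 ^ #(R ∩ R') : ℕ) : ℝ≥0∞) with hColl
  set t : ℝ≥0∞ := ENNReal.ofReal (η / 2) * Coll / (#Rs : ℝ≥0∞) with ht
  set c : ℝ≥0∞ := ENNReal.ofReal (1 / (2 * η)) * (#Rs : ℝ≥0∞) with hc
  set bad : Finset ((⊤ : SimpleGraph (Fin n)).edgeSet) → ℝ≥0∞ := fun R =>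
    (erdosRenyiHalf n).toOuterMeasure {x | ∃ j, g j (fun e => x e || decide (e ∈ R)) = b j} with hbad
  set f : EdgeVec n → Bool := fun y => F y (fun j => !g j y) with hf
  have hM0 : (#Rs : ℝ≥0∞) ≠ 0 := Nat.cast_ne_zero.2 hRs.card_pos.ne'
  have hMtop : (#Rs : ℝ≥0∞) ≠ ⊤ := ENNReal.natCast_ne_top _
  -- (1) null side, per `R`
  have hnull : ∀ R : Finset ((⊤ : SimpleGraph (Fin n)).edgeSet),
      (erdosRenyiHalf n).toOuterMeasure {x | F (fun e => x e || decide (e ∈ R)) b = true} ≤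
        (erdosRenyiHalf n).toOuterMeasure {x | f (fun e => x e || decide (e ∈ R)) = true} + bad R := by
    intro R
    refine le_trans (MeasureTheory.measure_mono fun x hx => ?_) (MeasureTheory.measure_union_le _ _)
    rcases shiftErrSum_null_subset F g b hF (fun e => x e || decide (e ∈ R)) hx with h | ⟨j, hbj, hgj⟩
    · exact Or.inl h
    · exact Or.inr ⟨j, hgj.trans hbj.symm⟩
  -- (2) planted side, per `R`
  have hplanted : ∀ R : Finset ((⊤ : SimpleGraph (Fin n)).edgeSet),
      (plantedCliqueDist n k).toOuterMeasure {x | F (fun e => x e || decide (e ∈ R)) b = false} ≤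
        (∑ A ∈ kSubsets n k, uA A *
            (erdosRenyiHalf n).toOuterMeasure {x | f (plant A (fun e => x e || decide (e ∈ R))) = false}) +
          bad R := by
    intro R
    rw [SliceTransport.plantedCliqueDist_apply_eq_sum (fun x => F (fun e => x e || decide (e ∈ R)) b)]
    have hfib : ∀ A : Finset (Fin n),
        (erdosRenyiHalf n).toOuterMeasure {x | F (fun e => plant A x e || decide (e ∈ R)) b = false} ≤
          (erdosRenyiHalf n).toOuterMeasure {x | f (plant A (fun e => x e || decide (e ∈ R))) = false} +
            bad R := by
      intro A
      refine le_trans (MeasureTheory.measure_mono fun x hx => ?_) (MeasureTheory.measure_union_le _ _)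
      have hx' : F (plant A (fun e => x e || decide (e ∈ R))) b = false := by
        rw [← shiftErrSum_plant_ins]; exact hx
      rcases shiftErrSum_planted_subset F g b hF hg
          (show (fun e => x e || decide (e ∈ R)) ≤ plant A (fun e => x e || decide (e ∈ R)) from
            fun e => le_plant A (fun e => x e || decide (e ∈ R)) e) hx' with h | ⟨j, hbj, hgj⟩
      · exact Or.inl h
      · exact Or.inr ⟨j, hgj.trans hbj.symm⟩
    calc ∑ A ∈ kSubsets n k, uA A *
          (erdosRenyiHalf n).toOuterMeasure {x | F (fun e => plant A x e || decide (e ∈ R)) b = false}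
        ≤ ∑ A ∈ kSubsets n k, uA A *
            ((erdosRenyiHalf n).toOuterMeasure {x | f (plant A (fun e => x e || decide (e ∈ R))) = false} +
              bad R) := sum_le_sum fun A _ => mul_le_mul_right (hfib A) _
      _ = (∑ A ∈ kSubsets n k, uA A *
            (erdosRenyiHalf n).toOuterMeasure {x | f (plant A (fun e => x e || decide (e ∈ R))) = false}) +
            ∑ A ∈ kSubsets n k, uA A * bad R := by
          rw [← sum_add_distrib]
          exact sum_congr rfl fun A _ => mul_add _ _ _
      _ = _ := by rw [shiftErrSum_sum_uniform_mul]
  -- (3) the transported null term, summed over `R`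
  have hsumNull : ∑ R ∈ Rs, (erdosRenyiHalf n).toOuterMeasure {x | f (fun e => x e || decide (e ∈ R)) = true} ≤
      t + c * (erdosRenyiHalf n).toOuterMeasure {x | f x = true} :=
    mixtureErrSum_sum_measure_le Rs hRs f hη
  -- (4) the transported planted term, summed over `R`
  have hsumPl : ∑ R ∈ Rs, ∑ A ∈ kSubsets n k, uA A *
        (erdosRenyiHalf n).toOuterMeasure {x | f (plant A (fun e => x e || decide (e ∈ R))) = false} ≤
      t + c * (plantedCliqueDist n k).toOuterMeasure {x | f x = false} := by
    rw [sum_comm]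
    have hA : ∀ A : Finset (Fin n), ∑ R ∈ Rs,
        (erdosRenyiHalf n).toOuterMeasure {x | f (plant A (fun e => x e || decide (e ∈ R))) = false} ≤
          t + c * (erdosRenyiHalf n).toOuterMeasure {x | f (plant A x) = false} := by
      intro A
      have h := mixtureErrSum_sum_measure_le Rs hRs (fun y => !f (plant A y)) hη
      have e1 : ∀ R : Finset ((⊤ : SimpleGraph (Fin n)).edgeSet),
          {x : EdgeVec n | (!f (plant A (fun e => x e || decide (e ∈ R)))) = true} =
            {x | f (plant A (fun e => x e || decide (e ∈ R))) = false} := fun R => Set.ext fun x => by simp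
      have e2 : {x : EdgeVec n | (!f (plant A x)) = true} = {x | f (plant A x) = false} := Set.ext fun x => by simp
      simp only [e1, e2] at h
      exact h
    calc ∑ A ∈ kSubsets n k, ∑ R ∈ Rs, uA A *
          (erdosRenyiHalf n).toOuterMeasure {x | f (plant A (fun e => x e || decide (e ∈ R))) = false}
        = ∑ A ∈ kSubsets n k, uA A * ∑ R ∈ Rs,
            (erdosRenyiHalf n).toOuterMeasure {x | f (plant A (fun e => x e || decide (e ∈ R))) = false} := by
          refine sum_congr rfl fun A _ => ?_
          rw [mul_sum]
      _ ≤ ∑ A ∈ kSubsets n k, uA A * (t + c * (erdosRenyiHalf n).toOuterMeasure {x | f (plant A x) = false}) :=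
          sum_le_sum fun A _ => mul_le_mul_right (hA A) _
      _ = t + c * (∑ A ∈ kSubsets n k, uA A * (erdosRenyiHalf n).toOuterMeasure {x | f (plant A x) = false}) := by
          have hsplit : ∀ A : Finset (Fin n),
              uA A * (t + c * (erdosRenyiHalf n).toOuterMeasure {x | f (plant A x) = false}) =
              uA A * t + c * (uA A * (erdosRenyiHalf n).toOuterMeasure {x | f (plant A x) = false}) := fun A => by
            ring
          simp only [hsplit, sum_add_distrib, ← mul_sum]
          rw [shiftErrSum_sum_uniform_mul]
      _ = _ := by rw [← SliceTransport.plantedCliqueDist_apply_eq_sum f]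
  -- (5) the target constant and the sum of the error sums over `R`
  set B : ℝ≥0∞ := ENNReal.ofReal η * Coll / ((#Rs : ℝ≥0∞) ^ 2) +
      ENNReal.ofReal (1 / η) * ((erdosRenyiHalf n).toOuterMeasure {x | f x = true} +
        (plantedCliqueDist n k).toOuterMeasure {x | f x = false}) +
      2 * (∑ R' ∈ Rs, bad R') / (#Rs : ℝ≥0∞) with hB
  -- `#Rs * B` dominates `2 t + c (μ₀ + μ₁) + 2 Σ bad`
  have htt : t + t = (#Rs : ℝ≥0∞) * (ENNReal.ofReal η * Coll / ((#Rs : ℝ≥0∞) ^ 2)) := by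
    have h2 : (2 : ℝ≥0∞) * ENNReal.ofReal (η / 2) = ENNReal.ofReal η := by
      rw [← ENNReal.ofReal_ofNat 2, ← ENNReal.ofReal_mul (by norm_num)]
      congr 1; ring
    have lhs : t + t = ENNReal.ofReal η * Coll * (#Rs : ℝ≥0∞)⁻¹ := by
      rw [ht, ← two_mul, div_eq_mul_inv, ← h2]; ring
    have rhs : (#Rs : ℝ≥0∞) * (ENNReal.ofReal η * Coll / ((#Rs : ℝ≥0∞) ^ 2)) =
        ENNReal.ofReal η * Coll * (#Rs : ℝ≥0∞)⁻¹ := by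
      rw [div_eq_mul_inv, sq, ENNReal.mul_inv (Or.inl hM0) (Or.inl hMtop)]
      calc (#Rs : ℝ≥0∞) * (ENNReal.ofReal η * Coll * ((#Rs : ℝ≥0∞)⁻¹ * (#Rs : ℝ≥0∞)⁻¹))
          = ENNReal.ofReal η * Coll * (#Rs : ℝ≥0∞)⁻¹ * ((#Rs : ℝ≥0∞) * (#Rs : ℝ≥0∞)⁻¹) := by ring
        _ = ENNReal.ofReal η * Coll * (#Rs : ℝ≥0∞)⁻¹ := by rw [ENNReal.mul_inv_cancel hM0 hMtop, mul_one]
    rw [lhs, rhs]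
  have hcc : c * ((erdosRenyiHalf n).toOuterMeasure {x | f x = true} +
      (plantedCliqueDist n k).toOuterMeasure {x | f x = false}) ≤
      (#Rs : ℝ≥0∞) * (ENNReal.ofReal (1 / η) * ((erdosRenyiHalf n).toOuterMeasure {x | f x = true} +
        (plantedCliqueDist n k).toOuterMeasure {x | f x = false})) := by
    have h12 : ENNReal.ofReal (1 / (2 * η)) ≤ ENNReal.ofReal (1 / η) :=
      ENNReal.ofReal_le_ofReal (by rw [one_div_le_one_div (by positivity) hη]; linarith)
    calc c * ((erdosRenyiHalf n).toOuterMeasure {x | f x = true} +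
          (plantedCliqueDist n k).toOuterMeasure {x | f x = false})
        ≤ ENNReal.ofReal (1 / η) * (#Rs : ℝ≥0∞) * ((erdosRenyiHalf n).toOuterMeasure {x | f x = true} +
          (plantedCliqueDist n k).toOuterMeasure {x | f x = false}) := mul_le_mul' (mul_le_mul' h12 le_rfl) le_rfl
      _ = _ := by ring
  have hbb : 2 * ∑ R ∈ Rs, bad R = (#Rs : ℝ≥0∞) * (2 * (∑ R' ∈ Rs, bad R') / (#Rs : ℝ≥0∞)) := by
    rw [ENNReal.mul_div_cancel hM0 hMtop]
  have htotal : ∑ R ∈ Rs, ((erdosRenyiHalf n).toOuterMeasure {x | F (fun e => x e || decide (e ∈ R)) b = true} +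
      (plantedCliqueDist n k).toOuterMeasure {x | F (fun e => x e || decide (e ∈ R)) b = false}) ≤
      ∑ _R ∈ Rs, B := by
    calc ∑ R ∈ Rs, ((erdosRenyiHalf n).toOuterMeasure {x | F (fun e => x e || decide (e ∈ R)) b = true} +
          (plantedCliqueDist n k).toOuterMeasure {x | F (fun e => x e || decide (e ∈ R)) b = false})
        ≤ ∑ R ∈ Rs, (((erdosRenyiHalf n).toOuterMeasure {x | f (fun e => x e || decide (e ∈ R)) = true} + bad R) +
            ((∑ A ∈ kSubsets n k, uA A *
              (erdosRenyiHalf n).toOuterMeasure {x | f (plant A (fun e => x e || decide (e ∈ R))) = false}) +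
              bad R)) := sum_le_sum fun R _ => add_le_add (hnull R) (hplanted R)
      _ = (∑ R ∈ Rs, (erdosRenyiHalf n).toOuterMeasure {x | f (fun e => x e || decide (e ∈ R)) = true}) +
            (∑ R ∈ Rs, ∑ A ∈ kSubsets n k, uA A *
              (erdosRenyiHalf n).toOuterMeasure {x | f (plant A (fun e => x e || decide (e ∈ R))) = false}) +
            2 * ∑ R ∈ Rs, bad R := by
          simp only [sum_add_distrib, two_mul]
          ring
      _ ≤ (t + c * (erdosRenyiHalf n).toOuterMeasure {x | f x = true}) +
            (t + c * (plantedCliqueDist n k).toOuterMeasure {x | f x = false}) +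
            2 * ∑ R ∈ Rs, bad R := add_le_add (add_le_add hsumNull hsumPl) le_rfl
      _ = (t + t) + c * ((erdosRenyiHalf n).toOuterMeasure {x | f x = true} +
            (plantedCliqueDist n k).toOuterMeasure {x | f x = false}) + 2 * ∑ R ∈ Rs, bad R := by ring
      _ ≤ (#Rs : ℝ≥0∞) * (ENNReal.ofReal η * Coll / ((#Rs : ℝ≥0∞) ^ 2)) +
            (#Rs : ℝ≥0∞) * (ENNReal.ofReal (1 / η) * ((erdosRenyiHalf n).toOuterMeasure {x | f x = true} +
              (plantedCliqueDist n k).toOuterMeasure {x | f x = false})) +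
            (#Rs : ℝ≥0∞) * (2 * (∑ R' ∈ Rs, bad R') / (#Rs : ℝ≥0∞)) :=
          add_le_add (add_le_add htt.le hcc) hbb.le
      _ = (#Rs : ℝ≥0∞) * B := by rw [hB]; ring
      _ = ∑ _R ∈ Rs, B := by rw [sum_const, nsmul_eq_mul]
  obtain ⟨R, hRP, hR⟩ := ENNReal.exists_le_of_sum_le hRs htotal
  exact ⟨R, hRP, by simpa only [hB, hf, hColl] using hR⟩

end Summit.PneNP.PneNP.Theorems.MonotoneSuffices.DensityShift
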